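import Mathlib
import Literature.NumberTheory.Automorphic.GreenLevelTwoEichlerIntegral
import Literature.NumberTheory.ModularForms.EisensteinLevelTwoHypergeometric
import HarnessLib

/-!
# Zhou 2015, Remark 9 (iii)a: `G₂^{Γ₀(2)}((i−1)/2, i/√2) = −(π/√2) ∫₀¹ P_{−1/4}(ξ)² dξ`

[topic NumberTheory/Automorphic]

Support file for `Literature.NumberTheory.Automorphic.Zhou2015_legendreP_sq_integral`: the level-two
Green's-function conjunct, in the tree's normalisation `higherGreen 2 2 1 = 2·G₂^{ℌ/Γ̄₀(2)}`:
`higherGreen 2 2 1 cmLevelTwo cmLevelTwo' = −(2π/√2) ∫₀¹ P_{−1/4}(ξ)² dξ`, assembled from the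
Eichler-integral construction of `G₂^{Γ₀(2)}(·, (i−1)/2)` (`GreenLevelTwoEichlerIntegral`) and the two
real-axis inputs of `EisensteinLevelTwoHypergeometric` (`f₂(it) ∈ ℝ` and
`∫_{t>1/√2} f₂(it) dt = (256π)⁻¹ ∫₀¹ P_{−1/4}²`).

## References

* Y. Zhou, *Kontsevich–Zagier integrals for automorphic Green's functions. I*, Ramanujan J. 38
  (2015), Remark 9, eq. (G2_Hecke2_spec_val) (arXiv p. 19). [cite: Zhou2015, Remark 9]
-/

noncomputable section

open Real MeasureTheory intervalIntegral

namespace Literature.NumberTheory.Automorphic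

open Literature.NumberTheory.ModularForms (fTwo_axisPt_real integral_fTwo_axis)

/-- **Zhou 2015, Remark 9, level two**: `higherGreen 2 2 1 ((i−1)/2) (i/√2) = −(2π/√2) ∫₀¹ P_{−1/4}(ξ)² dξ`,
i.e. `G₂^{ℌ/Γ̄₀(2)}((i−1)/2, i/√2) = −(π/√2) ∫₀¹ [P_{−1/4}(ξ)]² dξ`. [cite: Zhou2015, Remark 9, eq. (G2_Hecke2_spec_val) (arXiv p. 19)] -/
theorem higherGreen_two_cmLevelTwo_cmLevelTwo' :
    higherGreen 2 2 1 cmLevelTwo cmLevelTwo' =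
      -(2 * π / √2) * ∫ ξ in (0 : ℝ)..1, legendreP (-1 / 4) ξ ^ 2 :=
  GreenTwo.higherGreen_cmLevelTwo_of_axis fTwo_axisPt_real integral_fTwo_axis

end Literature.NumberTheory.Automorphic

end
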